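import Summits.Ventures.Crystal3D.Statement
import Summits.Ventures.Crystal3D.StickySpheres.Asymptotics
import HarnessLib

/-!
# Bulk crystallization of sticky spheres — the counting half

HONEST FRAMING. Part of the venture `Summits/Ventures/Crystal3D` (cell `pub-crystal3d`, phase 2).
This file PROVES, with no `sorry` and no named-fact hypothesis, the finite-sum bookkeeping behind
the cell's reduction "bulk crystallization ⇐ a local rule for saturated balls" (cell files
`PLAN.md` R39.1 (a)–(c), `ref2/SCORE-VACUITY.md`). It does NOT define the close-packed (fcc/hcp,
Barlow) first-shell predicate and does NOT state or assume the local lemma `L12(1)` ("a ball with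
twelve contacts all of whose twelve neighbours have twelve contacts has a cuboctahedral or
twisted-cuboctahedral shell" — the GLOBAL form is Hales 2012, arXiv:1209.6043, Theorem 1; the local
form is Flatley–Tarasov–Taylor–Theil 2013 Conjecture 2 + Theorem 4, OPEN as printed): both live in
the statement file of the seat `typer-bulk`. Everything here is generic over an arbitrary set `D`
of "defective" balls (or an arbitrary predicate), so that the statement file instantiates it in
one line and the two files have no mutual import. NO crystallization theorem is claimed.

## Content

* (any dimension) `card_coordination_lt_add_two_mul_numContacts_le`: if every ball has `≤ k`
  contacts then `#{i : deg i < k} + 2·C(x) ≤ k·N` (deficit counting: `Σᵢ (k - deg i) = kN - 2C(x)`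
  and every unsaturated ball has deficit `≥ 1`); `card_le_mul_card_of_cover`: if every ball of `B`
  touches a ball of `A` and balls of `A` have `≤ k` contacts then `#B ≤ k·#A`.
* (`ℝ³`, kissing number twelve from the tree, `coordination_le_twelve`)
  `card_coordination_lt_twelve_add_le`: `#{i : deg i < 12} + 2·C(x) ≤ 12N`;
  `card_add_le_of_unsaturated_neighbor`: for ANY set `D` of balls such that every saturated ball
  of `D` has an unsaturated contact neighbour, `#D + 24·C(x) ≤ 144N`, i.e. `#D ≤ 24(6N - C(x))`
  (`#D ≤ #A + #B`, `#B ≤ 11·#A`, `#A ≤ 12N - 2C(x)` with `A` = unsaturated balls, `B` = saturated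
  balls of `D`); predicate form `card_not_add_le_of_localRule`.
* `six_mul_sub_rpow_le_maxContacts`: the fcc deficit bound `6N - 54·N^{2/3} ≤ C(N)` for every `N`
  (canonical home of this theorem; the duplicate copy in `Bulk/LocalTwelve.lean` was removed 2026-08-22, p337004)
  (the tree's `maxContacts_div_ge`, i.e. fcc cubes + monotonicity, multiplied out; `54` is crude —
  the true order along octahedral `N` is `∛486 ≈ 7.86` — but explicit);
  `IsStickyGroundState.six_mul_sub_numContacts_le`: a sticky ground state misses at most
  `54·N^{2/3}` contacts from `6N`.
* The reduction, generic: `IsStickyGroundState.card_le_of_unsaturated_neighbor` /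
  `IsStickyGroundState.card_not_le_of_localRule`: in a sticky ground state of `N` balls, any such
  `D` has `#D ≤ 1296·N^{2/3}`; `almostAll_of_localRule`: a local rule valid in every finite unit
  packing of `ℝ³` ("saturated with saturated neighbours ⇒ good") makes all but `1296·N^{2/3}`
  balls of every sticky ground state good — the statement file's
  `L12Local → BulkCrystallization3D` is this with `Good` := close-packed shell.
* Unconditional instances (also the non-vacuity witnesses of the schema):
  `IsStickyGroundState.card_coordination_lt_twelve_le` — all but `108·N^{2/3}` balls of a sticky
  ground state have exactly twelve contacts; `IsStickyGroundState.card_not_saturatedCore_le` — all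
  but `1296·N^{2/3}` have twelve contacts AND twelve saturated neighbours.

## Sources (for orientation; nothing is vendored)

T. C. Hales, *Sphere packings with kissing number twelve* [arXiv:1209.6043], Theorem 1 (global
form). L. Flatley, A. Tarasov, R. Taylor, F. Theil, *Packing twelve spherical caps to maximize
tangencies*, J. Comput. Appl. Math. 254 (2013), Theorem 4 and Conjecture 2. R. C. Heitmann,
C. Radin, J. Stat. Phys. 22 (1980) 281–287 (the two-dimensional model). The constant bookkeeping
`K = 24 · 54 = 1296` is the cell's (`ref2/SCORE-VACUITY.md`).
-/

noncomputable section

open scoped BigOperators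
open Finset

namespace Summit.Ventures.Crystal3D

variable {d N : ℕ}

/-! ## Deficit counting and covering (any dimension) -/

section AnyDimension

variable (x : Fin N → EuclideanSpace ℝ (Fin d))

/-- **Deficit counting.** If every ball of the configuration `x` has at most `k` contacts, then
the number of balls with fewer than `k` contacts plus twice the contact number is at most `k N`:
`#{i : deg i < k} + 2·C(x) ≤ k·N`. (Handshake `Σ deg = 2C(x)`; an unsaturated ball contributes
`deg + 1 ≤ k`, a saturated one `deg ≤ k`.) -/
theorem card_coordination_lt_add_two_mul_numContacts_le {k : ℕ}
    (hk : ∀ i, coordination x i ≤ k) :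
    (univ.filter fun i => coordination x i < k).card + 2 * numContacts x ≤ k * N := by
  classical
  rw [← sum_coordination_eq, card_filter, ← sum_add_distrib]
  calc ∑ i, ((if coordination x i < k then 1 else 0) + coordination x i)
        ≤ ∑ _i : Fin N, k := by
          refine sum_le_sum fun i _ => ?_
          have hi := hk i
          split_ifs with h
          · omega
          · omega
    _ = k * N := by simp [mul_comm]

/-- **Covering count.** If every ball of `B` is a contact neighbour of some ball of `A`, and
every ball of `A` has at most `k` contacts, then `#B ≤ k · #A` (`B ⊆ ⋃_{a ∈ A} N(a)`). -/
theorem card_le_mul_card_of_cover {A B : Finset (Fin N)} {k : ℕ}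
    (hcover : ∀ b ∈ B, ∃ a ∈ A, b ∈ contactNeighbors x a)
    (hdeg : ∀ a ∈ A, coordination x a ≤ k) : B.card ≤ k * A.card := by
  classical
  calc B.card ≤ (A.biUnion fun a => contactNeighbors x a).card := by
        refine card_le_card fun b hb => ?_
        obtain ⟨a, ha, hba⟩ := hcover b hb
        exact mem_biUnion.2 ⟨a, ha, hba⟩
    _ ≤ ∑ a ∈ A, (contactNeighbors x a).card := card_biUnion_le
    _ ≤ ∑ _a ∈ A, k := sum_le_sum fun a ha => hdeg a ha
    _ = k * A.card := by simp [mul_comm]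

end AnyDimension

/-! ## Three dimensions: kissing number twelve -/

section ThreeDimensions

variable {x : Fin N → EuclideanSpace ℝ (Fin 3)}

/-- In a packing of unit-diameter balls in `ℝ³`: `#{i : deg i < 12} + 2·C(x) ≤ 12N`
(deficit counting with the kissing number, `coordination_le_twelve`). In particular the number of
UNSATURATED balls (fewer than twelve contacts) is at most `12N - 2C(x) = 2(6N - C(x))`. -/
theorem card_coordination_lt_twelve_add_le (hx : IsUnitPacking x) :
    (univ.filter fun i => coordination x i < 12).card + 2 * numContacts x ≤ 12 * N :=
  card_coordination_lt_add_two_mul_numContacts_le x (coordination_le_twelve hx)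

/-- In a packing in `ℝ³` a ball that does not have exactly twelve contacts has fewer. -/
theorem coordination_lt_twelve_of_ne (hx : IsUnitPacking x) {i : Fin N}
    (h : coordination x i ≠ 12) : coordination x i < 12 :=
  lt_of_le_of_ne (coordination_le_twelve hx i) h

/-- **The defect count** (R39.1 (a)–(c) of the cell's plan, generic). Let `x` be a packing of `N`
unit-diameter balls in `ℝ³` and `D` ANY set of balls such that every saturated ball of `D`
(twelve contacts) has a contact neighbour that is not saturated. Then
`#D + 24·C(x) ≤ 144·N`, i.e. `#D ≤ 24·(6N - C(x))`.
Proof: with `A` = unsaturated balls and `B` = saturated balls of `D`: `#D ≤ #A + #B`; every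
`b ∈ B` touches some `a ∈ A` and `deg a ≤ 11`, so `#B ≤ 11·#A`; and `#A ≤ 12N - 2C(x)`. -/
theorem card_add_le_of_unsaturated_neighbor (hx : IsUnitPacking x) {D : Finset (Fin N)}
    (hD : ∀ i ∈ D, coordination x i = 12 → ∃ j ∈ contactNeighbors x i, coordination x j ≠ 12) :
    D.card + 24 * numContacts x ≤ 144 * N := by
  classical
  set A : Finset (Fin N) := univ.filter fun i => coordination x i < 12
  have hA : A.card + 2 * numContacts x ≤ 12 * N := card_coordination_lt_twelve_add_le hx
  -- split `D` into its unsaturated part (inside `A`) and its saturated part `B`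
  have hsplit : D.card ≤ A.card + (D.filter fun i => coordination x i = 12).card := by
    rw [← card_filter_add_card_filter_not (s := D) (fun i => coordination x i = 12),
      add_comm]
    refine Nat.add_le_add_right (card_le_card fun i hi => ?_) _
    rw [mem_filter] at hi
    exact mem_filter.2 ⟨mem_univ _, coordination_lt_twelve_of_ne hx hi.2⟩
  -- the saturated part is covered by the neighbourhoods of `A`, whose balls have `≤ 11` contacts
  have hB : (D.filter fun i => coordination x i = 12).card ≤ 11 * A.card := by
    refine card_le_mul_card_of_cover x (fun b hb => ?_) (fun a ha => ?_)
    · rw [mem_filter] at hb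
      obtain ⟨j, hj, hj12⟩ := hD b hb.1 hb.2
      exact ⟨j, mem_filter.2 ⟨mem_univ _, coordination_lt_twelve_of_ne hx hj12⟩,
        (mem_contactNeighbors_comm x).1 hj⟩
    · have := (mem_filter.1 ha).2
      omega
  omega

/-- **Predicate form** of the defect count. If a property `P` of balls is LOCALLY FORCED in the
packing `x` — every ball with twelve contacts all of whose contact neighbours have twelve contacts
satisfies `P` — then `#{i : ¬ P i} + 24·C(x) ≤ 144·N`. -/
theorem card_not_add_le_of_localRule (hx : IsUnitPacking x) (P : Fin N → Prop) [DecidablePred P]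
    (hP : ∀ i, coordination x i = 12 → (∀ j ∈ contactNeighbors x i, coordination x j = 12) → P i) :
    (univ.filter fun i => ¬ P i).card + 24 * numContacts x ≤ 144 * N := by
  refine card_add_le_of_unsaturated_neighbor hx fun i hi h12 => ?_
  by_contra h
  refine (mem_filter.1 hi).2 (hP i h12 fun j hj => ?_)
  by_contra hj12
  exact h ⟨j, hj, hj12⟩

/-- Real-number form of the defect count: `#D ≤ 24·(6N - C(x))`. -/
theorem card_le_mul_sub_of_unsaturated_neighbor (hx : IsUnitPacking x) {D : Finset (Fin N)}
    (hD : ∀ i ∈ D, coordination x i = 12 → ∃ j ∈ contactNeighbors x i, coordination x j ≠ 12) :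
    (D.card : ℝ) ≤ 24 * (6 * N - numContacts x) := by
  have h : (D.card : ℝ) + 24 * numContacts x ≤ 144 * N := by
    exact_mod_cast card_add_le_of_unsaturated_neighbor hx hD
  linarith

/-! ## The fcc deficit bound and sticky ground states -/

/-- **fcc deficit bound**: `6N - 54·N^{2/3} ≤ C(N)` for every `N` — the tree's
`maxContacts_div_ge` (`6 - 54·N^{-1/3} ≤ C(N)/N` for `N ≥ 1`, from the fcc cubes of
`StickySpheres/FccChunks.lean` and monotonicity of `C`) multiplied by `N`; trivial at `N = 0`. The
constant `54` is crude but explicit. -/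
theorem six_mul_sub_rpow_le_maxContacts (N : ℕ) :
    6 * (N : ℝ) - 54 * (N : ℝ) ^ ((2 : ℝ) / 3) ≤ (maxContacts 3 N : ℝ) := by
  rcases Nat.eq_zero_or_pos N with h | h
  · subst h
    simp [Real.zero_rpow (by norm_num : ((2 : ℝ) / 3) ≠ 0)]
  · have hN : (0 : ℝ) < N := by exact_mod_cast h
    have key := maxContacts_div_ge N h
    rw [le_div_iff₀ hN] at key
    have e : (N : ℝ) ^ (-(1 : ℝ) / 3) * N = (N : ℝ) ^ ((2 : ℝ) / 3) := by
      rw [show ((2 : ℝ) / 3) = -(1 : ℝ) / 3 + 1 by norm_num, Real.rpow_add_one hN.ne']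
    calc 6 * (N : ℝ) - 54 * (N : ℝ) ^ ((2 : ℝ) / 3)
          = (6 - 54 * (N : ℝ) ^ (-(1 : ℝ) / 3)) * N := by rw [← e]; ring
      _ ≤ maxContacts 3 N := key

/-- A sticky ground state of `N` balls in `ℝ³` misses at most `54·N^{2/3}` contacts from the
kissing bound: `6N - C(x) ≤ 54·N^{2/3}`. -/
theorem IsStickyGroundState.six_mul_sub_numContacts_le (hx : IsStickyGroundState x) :
    6 * (N : ℝ) - numContacts x ≤ 54 * (N : ℝ) ^ ((2 : ℝ) / 3) := by
  have h := six_mul_sub_rpow_le_maxContacts N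
  rw [← hx.2] at h
  linarith

/-- **The reduction, set form.** In a sticky ground state of `N` balls in `ℝ³`, any set `D` of
balls each of whose saturated members has an unsaturated contact neighbour satisfies
`#D ≤ 1296·N^{2/3}` (`1296 = 24 · 54`). -/
theorem IsStickyGroundState.card_le_of_unsaturated_neighbor (hx : IsStickyGroundState x)
    {D : Finset (Fin N)}
    (hD : ∀ i ∈ D, coordination x i = 12 → ∃ j ∈ contactNeighbors x i, coordination x j ≠ 12) :
    (D.card : ℝ) ≤ 1296 * (N : ℝ) ^ ((2 : ℝ) / 3) := by
  have h1 := card_le_mul_sub_of_unsaturated_neighbor hx.1 hD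
  have h2 := hx.six_mul_sub_numContacts_le
  linarith

/-- **The reduction, predicate form.** In a sticky ground state of `N` balls in `ℝ³`, a locally
forced property (`deg i = 12` and all contact neighbours of `i` have twelve contacts ⇒ `P i`)
fails for at most `1296·N^{2/3}` balls. -/
theorem IsStickyGroundState.card_not_le_of_localRule (hx : IsStickyGroundState x)
    (P : Fin N → Prop) [DecidablePred P]
    (hP : ∀ i, coordination x i = 12 → (∀ j ∈ contactNeighbors x i, coordination x j = 12) → P i) :
    ((univ.filter fun i => ¬ P i).card : ℝ) ≤ 1296 * (N : ℝ) ^ ((2 : ℝ) / 3) := by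
  have h1 : ((univ.filter fun i => ¬ P i).card : ℝ) + 24 * numContacts x ≤ 144 * N := by
    exact_mod_cast card_not_add_le_of_localRule hx.1 P hP
  have h2 := hx.six_mul_sub_numContacts_le
  linarith

/-- **Reduction schema for the statement file.** Let `Good x i` be any property of ball `i` in a
finite configuration `x` in `ℝ³`, and suppose the LOCAL RULE: in every finite unit packing, a ball
with twelve contacts all of whose contact neighbours have twelve contacts is good. Then in every
sticky ground state of `N` balls all but at most `1296·N^{2/3}` balls are good. (With `Good` :=
"the twelve neighbours form a cuboctahedral or twisted-cuboctahedral shell" the rule is the local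
lemma `L12(1)` and the conclusion is the cell's `BulkCrystallization3D` with `K = 1296`; neither
is defined here.) -/
theorem almostAll_of_localRule
    (Good : ∀ {M : ℕ}, (Fin M → EuclideanSpace ℝ (Fin 3)) → Fin M → Prop)
    (hrule : ∀ {M : ℕ} (y : Fin M → EuclideanSpace ℝ (Fin 3)), IsUnitPacking y → ∀ i,
      coordination y i = 12 → (∀ j ∈ contactNeighbors y i, coordination y j = 12) → Good y i)
    (hx : IsStickyGroundState x) [DecidablePred (Good x)] :
    ((univ.filter fun i => ¬ Good x i).card : ℝ) ≤ 1296 * (N : ℝ) ^ ((2 : ℝ) / 3) :=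
  hx.card_not_le_of_localRule (Good x) (hrule x hx.1)

/-! ## Unconditional instances (non-vacuity witnesses of the schema) -/

/-- **All but `108·N^{2/3}` balls of a sticky ground state are saturated**: the number of balls
with fewer than twelve contacts is at most `2(6N - C(x)) ≤ 108·N^{2/3}`. Unconditional. -/
theorem IsStickyGroundState.card_coordination_lt_twelve_le (hx : IsStickyGroundState x) :
    ((univ.filter fun i => coordination x i < 12).card : ℝ) ≤ 108 * (N : ℝ) ^ ((2 : ℝ) / 3) := by
  have h1 : ((univ.filter fun i => coordination x i < 12).card : ℝ) + 2 * numContacts x ≤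
      12 * N := by
    exact_mod_cast card_coordination_lt_twelve_add_le hx.1
  have h2 := hx.six_mul_sub_numContacts_le
  linarith

/-- **All but `1296·N^{2/3}` balls of a sticky ground state lie in the saturated core**: they have
twelve contacts and so do all their contact neighbours. Unconditional — the schema
`IsStickyGroundState.card_not_le_of_localRule` with the tautological rule; it shows the schema's
hypothesis shape is inhabited and locates the content of bulk crystallization in the local lemma
alone. -/
theorem IsStickyGroundState.card_not_saturatedCore_le (hx : IsStickyGroundState x) :
    ((univ.filter fun i => ¬ (coordination x i = 12 ∧
        ∀ j ∈ contactNeighbors x i, coordination x j = 12)).card : ℝ) ≤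
      1296 * (N : ℝ) ^ ((2 : ℝ) / 3) := by
  classical
  exact hx.card_not_le_of_localRule _ fun i h1 h2 => ⟨h1, h2⟩

end ThreeDimensions

end Summit.Ventures.Crystal3D

end
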